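import Summits.BirchSwinnertonDyer.Rank1Residual.SmallImageMu.GradedEulerLossEdges
import Summits.BirchSwinnertonDyer.Rank1Residual.X10.CoreTheoremAOddPrimeHolds
import Summits.BirchSwinnertonDyer.Rank1Residual.SmallImageMu.EulerLossZeroChart
import Summits.BirchSwinnertonDyer.Rank1Residual.SmallImageMu.KatoDivisibility
import Summits.BirchSwinnertonDyer.BirchSwinnertonDyer.Theses.OneSidedTwistSqueezeX9
import Literature.NumberTheory.EllipticCurves.IwasawaAlgebraMuQuotientProofs
import Literature.NumberTheory.EllipticCurves.Kim2025.IwasawaCohomologyZetaQuotientProofs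
import HarnessLib

set_option autoImplicit false

-- the summit and its single problem are both named `BirchSwinnertonDyer` (registry layout D-0017)
set_option linter.dupNamespace false

/-!
# Road (iii) «graded Euler loss» INTO the crux `KatoDivisibilityX9` (stmt-BirchSwinnertonDyer-20547):
# the edge S-es-3 ⟹ node modulo F1_ζ ALONE, and the `n = 0`-core slack «fine `μ ≤ 1` suffices»

Seat `bsd-line-k6-p4` (prover-bsd-line-k6-p4-g2-0; D-0154 KEY (146) row 9; route `OneSidedTwistSqueezeX9`; host cell
`bsd-f3-mu`, planner of record `-imc`).  THEOREMS ONLY, sorry-free, tree imports only, no definition, no new named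
fact, nothing asserted about any curve; binders = the ONE construction fact F1_ζ
(`Kato2004.exists_divisibilityInputs_fineQuotient_zeta`: Kato's §17.13 package with the fine quotient and the Thm. 12.6
span clause) and/or the OPEN typed nodes of `SmallImageMu/GradedEulerLoss.lean`, `EulerPrimitive.lean`.
`--supports stmt-BirchSwinnertonDyer-20547`.  WHY: LINE A (`Cruxes/KatoDivisibilityX9/Lines/conj_a_road.lean`,
a7d38013) reduces the crux to Conjecture A on X9 (`μ(X₀) = 0`, open-problem grade); road (iii) of its card — DEPTH
(ES-C4 `SIM.FineExponentLeEulerLossOnClassX9`, `n = 0` slice = the kernel core `X10.coreTheoremAOddPrime_holds`) ∧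
WIDTH (B2 `SIM.FineMuConcentratedOnClassX9`) ⟹ S-es-3 (`SIM.FineMuLeEulerLossOnClassX9`) — had its last arrow
«S-es-3 ⟹ node» at memo grade only (host 2026-08-28T06:16:45Z (c): binders F1_ζ, BCS (a), modularity, S-W⁺).

* §1 (NEW module algebra): `lengthAt_quotient_augIdealP_pow_smul_top_eq` — `ℓ_(p)(H/p^nH) = n` for a finitely
  generated non-zero `Λ`-module `H` EMBEDDING in `Λ`; `le_muInvariant_quotient_of_le_pow_smul_top_of_injective` —
  «depth ≤ loss» `0 ≠ Z ≤ p^nH ⟹ n ≤ μ(H/Z)` WITHOUT `H ≅ Λ` (the tree's version needs Kato Thm. 12.4 (3), the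
  undischarged `Kato2004.thm12_4`; the package embeds `𝐇¹ ↪ Λ` by `col ∘ loc`, which is all we use).
* §2 (per package): `le_eulerLoss_of_zetaModule_le_pow_smul_top`; `exists_isEulerSystemClass_not_mem_pow_eulerLoss_succ`
  (span clause ⟹ some GENUINE class has loss `≤ δ_Z := μ(𝐇¹/Z)`; graded form of the tree's (c7c));
  `one_le_eulerLoss_of_fineMu_ne_zero` (the `n = 0` core, contrapositive: at an X9 pair `μ(X₀) ≠ 0 ⟹ δ_Z ≥ 1`).
* §3: **`katoDivisibilityOnClassX9_of_fineMuLeEulerLossOnClassX9 : F1_ζ → S-es-3 → node`** (no `thm12_4`, no BCS (a),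
  no modularity witness — the node quantifies over the newforms of `W` — no S-W⁺); the route-decl form; and
  **`katoDivisibilityX9_of_depth_of_width : F1_ζ → ES-C4 → B2 → KatoDivisibilityX9`** = the kernel composition of the
  lead's second line `Cruxes/KatoDivisibilityX9/Lines/graded_euler_loss.lean`.
* §4: **`katoDivisibilityAt_of_fineMu_le_one`** — at an X9 pair whose finitely generated torsion dual fine Selmer data
  have `μ(X₀) ≤ 1`, `KatoDivisibilityAt W p` holds modulo F1_ζ alone (`μ(X₀) = 1 ⟹ δ_Z ≥ 1` by §2, then the es-g7
  lever `SIM.mem_charIdeal_of_fineMu_le_eulerLoss`); class-level and route-decl forms.  READING: LINE A's stub may be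
  weakened from `μ(X₀) = 0` to `μ(X₀) ≤ 1`; the open content of stmt-20547 sits on `{μ(X₀) ≥ 2} ∩ {δ_Z ≥ 1}`
  (`⊆ {μ^an ≥ 1}`; census X9-MU-TABLE v1.1: 0/790 such rows).

HONEST LABEL: every open node taken as a binder (ES-C4 for `n ≥ 1`, B2, S-es-3, «`μ(X₀) ≤ 1` on X9») is implied
in the tree by item 19630 modulo F1_ζ and is NOT in print (REF2-LITMAP M17 (e5), rows ES-C4 / B2); class-wide 20547
stays open-problem grade; PARTITION untouched (X9 790 = 130 + 36 + 624; 761/790 closed F1-free per pair);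
beyond-print theorem toward BSD: NO; BSD is not proved by any of this.

References: K. Kato, Astérisque 295 (2004), Thm. 12.4–12.6 (pp. 221–222), Thm. 13.4 (p. 226), §13.8, (14.9.3),
Thm. 17.4 (p. 273), Prop. 17.11 (p. 277), §17.13 (pp. 279–280) [Kato2004Asterisque]; R. Greenberg, V. Vatsal,
Invent. Math. 142 (2000) Prop. 3.7 [GreenbergVatsal2000]; R. Greenberg, LNM 1716 (1999) §1 p. 60, Conj. 1.11
[GreenbergLNM1716]; J. Coates, R. Sujatha, Math. Ann. 331 (2005) §3 Conj. A [CoatesSujatha2005]; S. Lang,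
*Cyclotomic Fields I and II* (1990) Ch. 5 §1 Thm. 1.2 [Lang1990]; L. Washington, GTM 83 §13.2 [Washington1997].
-/

noncomputable section

open scoped Classical MatrixGroups ModularForm NumberField
open CongruenceSubgroup WeierstrassCurve Field
open Literature.NumberTheory.GaloisRepresentations
open Literature.NumberTheory.EllipticCurves Literature.NumberTheory.EllipticCurves.ModularForms
open Literature.NumberTheory.EllipticCurves.Kato2004
open Literature.NumberTheory.EllipticCurves.Kato2004.EulerSystemValues
open Literature.NumberTheory.EllipticCurves.Rank1Residual (KatoDivisibilityAt)
open Summit.BirchSwinnertonDyer.BirchSwinnertonDyer.Rank1Residual (ClassX9)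
open Summit.BirchSwinnertonDyer.Rank1Residual.SmallImageMu (KatoDivisibilityOnClassX9
  FineMuLeEulerLossOnClassX9 FineExponentLeEulerLossOnClassX9 FineMuConcentratedOnClassX9
  fineMuLeEulerLossOnClassX9_of_exponent_of_concentrated zetaModule_ne_bot
  mem_charIdeal_of_fineMu_le_eulerLoss)
open Summit.BirchSwinnertonDyer.BirchSwinnertonDyer.Theses.OneSidedTwistSqueezeX9 (KatoDivisibilityX9)
open Module IwasawaAlgebra

namespace Summit.BirchSwinnertonDyer.BirchSwinnertonDyer.Theorems.OneSidedTwistSqueezeX9KatoDivisibilityX9OfGradedEulerLoss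

/-! ## §1 Module algebra over `Λ = ℤ_p⟦T⟧` at `𝔭 = (p)`: «Euler DEPTH ≤ Euler LOSS» WITHOUT a free `𝐇¹` -/

section Algebra

variable {R : Type*} [CommRing R] {H P : Type*} [AddCommGroup H] [_root_.Module R H]
  [AddCommGroup P] [_root_.Module R P]

/-- `ℓ_𝔭(P/c(Z)) = ℓ_𝔭(H/Z) + ℓ_𝔭(P/range c)` for an INJECTIVE `c : H → P` and `Z ≤ H` (private copy of the
folklore lemma of `Theorems.ThetaPartnerAtTwoSignedKatoUpToAtTwoOffTwoRoad`, to keep the import cone small). [folklore] -/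
private theorem lengthAt_quotient_map_eq_add (c : H →ₗ[R] P) (hc : Function.Injective c)
    (Z : Submodule R H) (𝔭 : PrimeSpectrum R) :
    lengthAt R (P ⧸ Submodule.map c Z) 𝔭 =
      lengthAt R (H ⧸ Z) 𝔭 + lengthAt R (P ⧸ LinearMap.range c) 𝔭 := by
  set M : Submodule R P := Submodule.map c Z with hM
  let φ : H →ₗ[R] P ⧸ M := M.mkQ ∘ₗ c
  have hkerφ : LinearMap.ker φ = Z := by
    rw [LinearMap.ker_comp, Submodule.ker_mkQ, hM, Submodule.comap_map_eq_of_injective hc]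
  have hrangeφ : LinearMap.range φ = (LinearMap.range c).map M.mkQ := LinearMap.range_comp _ _
  have hMle : M ≤ LinearMap.range c := by
    rw [hM, LinearMap.range_eq_map]; exact Submodule.map_mono le_top
  rw [lengthAt_eq_add_quotient (LinearMap.range φ) 𝔭]
  congr 1
  · rw [← lengthAt_eq_of_linearEquiv φ.quotKerEquivRange 𝔭,
      lengthAt_eq_of_linearEquiv (Submodule.quotEquivOfEq _ _ hkerφ) 𝔭]
  · rw [lengthAt_eq_of_linearEquiv (Submodule.quotEquivOfEq _ _ hrangeφ) 𝔭,
      lengthAt_eq_of_linearEquiv (Submodule.quotientQuotientEquivQuotient M (LinearMap.range c) hMle) 𝔭]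

end Algebra

section Lambda

variable {p : ℕ} [Fact p.Prime] {H : Type*} [AddCommGroup H] [_root_.Module (IwasawaAlgebra p) H]

/-- **`ℓ_(p)(H/p^nH) = n` for a finitely generated non-zero `Λ`-module `H` EMBEDDING in `Λ`** (free or not):
with `J = c(H)`, `ℓ(Λ/p^nJ) = ℓ(H/p^nH) + ℓ(Λ/J) = ℓ(Λ/J) + ℓ(Λ/(p^n))`, `ℓ_(p)(Λ/(p^n)) = n`, `ℓ_(p)(Λ/J) < ∞`.
Replaces Kato Thm. 12.4 (3) («`𝐇¹` free of rank one») in the depth-vs-loss bookkeeping.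
[cite: Lang1990, Ch. 5 §1 Thm. 1.2 (i) (`μ(Λ/p^m) = m`)] [cite: Washington1997, §13.2] -/
theorem lengthAt_quotient_augIdealP_pow_smul_top_eq [Module.Finite (IwasawaAlgebra p) H]
    (c : H →ₗ[IwasawaAlgebra p] IwasawaAlgebra p) (hc : Function.Injective c) (hH : ∃ h : H, h ≠ 0)
    (n : ℕ) (𝔭 : PrimeSpectrum (IwasawaAlgebra p)) (h𝔭 : 𝔭.asIdeal = augIdealP p) :
    lengthAt (IwasawaAlgebra p) (H ⧸ (augIdealP p ^ n) • (⊤ : Submodule (IwasawaAlgebra p) H)) 𝔭 = n := by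
  have h1ht : 𝔭.asIdeal.height = 1 := by rw [h𝔭]; exact height_augIdealP_holds p
  have hP0 : (PowerSeries.C ((p : ℤ_[p]) ^ n) : IwasawaAlgebra p) ≠ 0 := by
    rw [map_pow]; exact pow_ne_zero _ (prime_C p).ne_zero
  have hpn : (augIdealP p ^ n : Ideal (IwasawaAlgebra p)) =
      Ideal.span {(PowerSeries.C ((p : ℤ_[p]) ^ n) : IwasawaAlgebra p)} := by
    rw [augIdealP, Ideal.span_singleton_pow, map_pow]
  let m : IwasawaAlgebra p →ₗ[IwasawaAlgebra p] IwasawaAlgebra p :=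
    LinearMap.mulLeft (IwasawaAlgebra p) (PowerSeries.C ((p : ℤ_[p]) ^ n) : IwasawaAlgebra p)
  have hm : Function.Injective m := fun x y hxy ↦
    mul_left_cancel₀ hP0 (by simpa only [m, LinearMap.mulLeft_apply] using hxy)
  have hrange_m : LinearMap.range m =
      Ideal.span {(PowerSeries.C ((p : ℤ_[p]) ^ n) : IwasawaAlgebra p)} := by
    ext x; simp only [LinearMap.mem_range, LinearMap.mulLeft_apply, Ideal.mem_span_singleton', m]
    constructor
    · rintro ⟨y, rfl⟩; exact ⟨y, mul_comm y _⟩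
    · rintro ⟨y, rfl⟩; exact ⟨y, mul_comm _ y⟩
  have hmapc : Submodule.map c ((augIdealP p ^ n) • (⊤ : Submodule (IwasawaAlgebra p) H)) =
      Submodule.map m (LinearMap.range c) := by
    rw [Submodule.map_smul'', Submodule.map_top, hpn, Submodule.ideal_span_singleton_smul]
    ext x; rw [← SetLike.mem_coe, Submodule.coe_pointwise_smul, Set.mem_smul_set, Submodule.mem_map]
    simp only [SetLike.mem_coe, LinearMap.mulLeft_apply, smul_eq_mul, m]
  -- the two bookkeeping identities for `ℓ(Λ / p^n c(H))`; `ℓ_(p)(Λ/(p^n)) = n`; `ℓ_(p)(Λ/c(H)) < ∞`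
  have e1 := lengthAt_quotient_map_eq_add c hc ((augIdealP p ^ n) • ⊤) 𝔭
  have e2 := lengthAt_quotient_map_eq_add m hm (LinearMap.range c) 𝔭
  rw [hmapc] at e1
  rw [hrange_m] at e2
  have hn : lengthAt (IwasawaAlgebra p)
      (IwasawaAlgebra p ⧸ Ideal.span {(PowerSeries.C ((p : ℤ_[p]) ^ n) : IwasawaAlgebra p)}) 𝔭 = n := by
    rw [lengthAt_quotient_C_pow n 𝔭 h1ht, if_pos (by rw [h𝔭]; exact Ideal.subset_span rfl)]
    simp
  obtain ⟨h, hh⟩ := hH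
  have hch : c h ≠ 0 := fun h0 ↦ hh (hc (by rw [h0, map_zero]))
  have hby : Module.IsTorsionBy (IwasawaAlgebra p) (IwasawaAlgebra p ⧸ LinearMap.range c) (c h) :=
    (Module.isTorsionBy_quotient_iff _ _).mpr fun y ↦
      ⟨y • h, by rw [map_smul, smul_eq_mul, smul_eq_mul, mul_comm]⟩
  have hJfin : lengthAt (IwasawaAlgebra p) (IwasawaAlgebra p ⧸ LinearMap.range c) 𝔭 ≠ ⊤ :=
    Module.lengthAt_ne_top_of_isTorsionBy hch hby 𝔭 (le_of_eq h1ht)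
  -- cancel the finite `ℓ(Λ/c(H))` in `↑n + ℓ(Λ/c(H)) = ℓ(H/p^nH) + ℓ(Λ/c(H))`
  rw [hn, add_comm] at e2
  rw [e2] at e1
  obtain ⟨j, hj⟩ := ENat.ne_top_iff_exists.mp hJfin
  rw [← hj] at e1
  by_cases htop : lengthAt (IwasawaAlgebra p)
      (H ⧸ (augIdealP p ^ n) • (⊤ : Submodule (IwasawaAlgebra p) H)) 𝔭 = ⊤
  · rw [htop, top_add] at e1
    exact absurd e1 (by exact_mod_cast ENat.coe_ne_top (n + j))
  · obtain ⟨l, hl⟩ := ENat.ne_top_iff_exists.mp htop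
    rw [← hl] at e1 ⊢
    have e1' : n + j = l + j := by exact_mod_cast e1
    exact_mod_cast (Nat.add_right_cancel e1').symm

/-- **Euler DEPTH ≤ Euler LOSS without a free `𝐇¹`**: `c : H ↪ Λ`, `H` finitely generated, `0 ≠ Z ≤ p^n H`
⟹ `n ≤ μ(H/Z)` (`H/Z ↠ H/p^nH` of `ℓ_(p) = n`; `c z` kills `H/Z`).  The tree's
`le_muInvariant_quotient_of_le_pow_smul_top` is the case `H ≃ Λ` (Kato Thm. 12.4 (3)).
[cite: Lang1990, Ch. 5 §1 Thm. 1.2 (i)] [cite: Kato2004Asterisque, Prop. 17.11 and (17.13.2) (pp. 277, 279)] -/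
theorem le_muInvariant_quotient_of_le_pow_smul_top_of_injective [Module.Finite (IwasawaAlgebra p) H]
    (c : H →ₗ[IwasawaAlgebra p] IwasawaAlgebra p) (hc : Function.Injective c)
    {Z : Submodule (IwasawaAlgebra p) H} (hZ : Z ≠ ⊥) {n : ℕ}
    (hZn : Z ≤ (augIdealP p ^ n) • (⊤ : Submodule (IwasawaAlgebra p) H)) :
    n ≤ muInvariant p (H ⧸ Z) := by
  let 𝔭 : PrimeSpectrum (IwasawaAlgebra p) := ⟨augIdealP p, isPrime_augIdealP_holds p⟩
  obtain ⟨z, hzZ, hz0⟩ := (Submodule.ne_bot_iff Z).mp hZ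
  have hn := lengthAt_quotient_augIdealP_pow_smul_top_eq c hc ⟨z, hz0⟩ n 𝔭 rfl
  -- `H/Z ↠ H/p^nH`, and `ℓ_(p)(H/Z) < ∞` because `c z` kills `H/Z`
  have hle : lengthAt (IwasawaAlgebra p) (H ⧸ (augIdealP p ^ n) • (⊤ : Submodule (IwasawaAlgebra p) H)) 𝔭
      ≤ lengthAt (IwasawaAlgebra p) (H ⧸ Z) 𝔭 :=
    lengthAt_le_of_surjective (Submodule.mapQ Z ((augIdealP p ^ n) • ⊤) LinearMap.id fun x hx ↦ hZn hx)
      (fun y ↦ by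
        obtain ⟨x, rfl⟩ := Submodule.mkQ_surjective _ y
        exact ⟨Submodule.Quotient.mk x, rfl⟩) 𝔭
  have hcz : c z ≠ 0 := fun h0 ↦ hz0 (hc (by rw [h0, map_zero]))
  have hby : Module.IsTorsionBy (IwasawaAlgebra p) (H ⧸ Z) (c z) :=
    (Module.isTorsionBy_quotient_iff _ _).mpr fun y ↦ by
      have hker : c (c z • y - c y • z) = 0 := by
        rw [map_sub, map_smul, map_smul, smul_eq_mul, smul_eq_mul, mul_comm, sub_self]
      rw [sub_eq_zero.mp (hc (by rw [hker, map_zero]) : c z • y - c y • z = 0)]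
      exact Z.smul_mem _ hzZ
  have hfin : lengthAt (IwasawaAlgebra p) (H ⧸ Z) 𝔭 ≠ ⊤ :=
    Module.lengthAt_ne_top_of_isTorsionBy hcz hby 𝔭 (le_of_eq (height_augIdealP_holds p))
  rw [muInvariant_eq_toNat_lengthAt p _ 𝔭 rfl]
  obtain ⟨d, hd⟩ := ENat.ne_top_iff_exists.mp hfin
  rw [← hd, hn] at hle
  rw [← hd, ENat.toNat_coe]
  exact_mod_cast hle

end Lambda

/-! ## §2 Per package: depth ≤ loss for the §17.13 zeta module (no `thm12_4`); a genuine class of loss `≤ δ_Z` -/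

section Package

variable {p : ℕ} [Fact p.Prime] {W : WeierstrassCurve ℚ} [W.IsElliptic] [W.IsGloballyMinimal]
  [ContinuousSMul ℤ_[p] (W.tateModule p)] {N : ℕ} {f : CuspForm (Gamma0 N) 2}
  {κ : ZpExtension ℚ p} {γ : absoluteGaloisGroup ℚ}
  {I : IwasawaH1Data W p κ γ} {D : W.SelmerDualData κ γ}

/-- **Depth ≤ loss on a §17.13 package, WITHOUT `thm12_4`**: `Z ≤ p^n 𝐇¹` and `L_p(f, α) ≠ 0` ⟹
`n ≤ δ_Z := μ(𝐇¹/Z)`, via the package's own embedding `col ∘ loc : 𝐇¹ ↪ Λ` (cf. the tree's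
`SIM.le_muInvariant_quotient_zetaModule`, which binds a free rank-one `𝐇¹`).
[cite: Kato2004Asterisque, Prop. 17.11 (p. 277), (17.13.2) (p. 279), Thm. 12.6 (p. 222)] -/
theorem le_eulerLoss_of_zetaModule_le_pow_smul_top (K : DivisibilityInputs W p f κ γ I D)
    (hL : padicLFunction f (unitRoot W p : ℚ_[p]) ≠ 0) {n : ℕ}
    (hZn : K.Z ≤ (augIdealP p ^ n) • (⊤ : Submodule (IwasawaAlgebra p) I.H)) :
    n ≤ muInvariant p (I.H ⧸ K.Z) := by
  haveI : Module.Finite (IwasawaAlgebra p) I.H := Kim2025.moduleFinite_H1_of_package K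
  exact le_muInvariant_quotient_of_le_pow_smul_top_of_injective (K.col ∘ₗ K.loc)
    (Kim2025.colLoc_injective K) (zetaModule_ne_bot K hL) hZn

/-- **Some GENUINE Euler-system class has Euler loss `≤ δ_Z`** (span clause `Z ≤ span {genuine classes}`: were
every genuine class in `p^{δ_Z+1} 𝐇¹`, so would be `Z`, forcing `δ_Z + 1 ≤ δ_Z`); the graded, free-`𝐇¹`-free form
of the tree's (c7c). [cite: Kato2004Asterisque, Thm. 12.6 (p. 222) and §13.8] -/
theorem exists_isEulerSystemClass_not_mem_pow_eulerLoss_succ [Module.Free ℤ_[p] (W.tateModule p)]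
    [Module.Finite ℤ_[p] (W.tateModule p)] (K : DivisibilityInputs W p f κ γ I D)
    (hL : padicLFunction f (unitRoot W p : ℚ_[p]) ≠ 0)
    (hZ : K.Z ≤ Submodule.span (IwasawaAlgebra p) {s : I.H | IsEulerSystemClass W p κ γ I s}) :
    ∃ s : I.H, IsEulerSystemClass W p κ γ I s ∧
      s ∉ (augIdealP p ^ (muInvariant p (I.H ⧸ K.Z) + 1)) • (⊤ : Submodule (IwasawaAlgebra p) I.H) := by
  by_contra hall
  simp only [not_exists, not_and, not_not] at hall
  have hZle : K.Z ≤ (augIdealP p ^ (muInvariant p (I.H ⧸ K.Z) + 1)) •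
      (⊤ : Submodule (IwasawaAlgebra p) I.H) :=
    hZ.trans (Submodule.span_le.mpr fun s hs ↦ hall s hs)
  have := le_eulerLoss_of_zetaModule_le_pow_smul_top K hL hZle
  omega

/-- **The `n = 0` core, contrapositive, in `μ`-currency**: at an X9 pair, `μ(Y.X) ≠ 0 ⟹ δ_Z ≥ 1` (if `δ_Z = 0`
some genuine class `∉ p𝐇¹`; the KERNEL core `X10.coreTheoremAOddPrime_holds` kills `Sel₀(ℚ_∞, E[p^∞])[p]` by a
power of `γ − 1`, so `Y.X/pY.X` is finite and `μ(Y.X) = 0`). [cite: Kato2004Asterisque, Thm. 12.6 (p. 222), §13.8]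
[cite: GreenbergLNM1716, §1 p. 60 (after Conj. 1.3)] -/
theorem one_le_eulerLoss_of_fineMu_ne_zero [Module.Free ℤ_[p] (W.tateModule p)]
    [Module.Finite ℤ_[p] (W.tateModule p)] (hX9 : ClassX9 W p) (hκ : κ.IsCyclotomic)
    (hγ : κ.IsTopGenerator γ) (K : DivisibilityInputs W p f κ γ I D)
    (hL : padicLFunction f (unitRoot W p : ℚ_[p]) ≠ 0)
    (hZ : K.Z ≤ Submodule.span (IwasawaAlgebra p) {s : I.H | IsEulerSystemClass W p κ γ I s})
    (Y : W.FineSelmerDualData κ γ) [Module.Finite (IwasawaAlgebra p) Y.X]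
    (hY : muInvariant p Y.X ≠ 0) : 1 ≤ muInvariant p (I.H ⧸ K.Z) := by
  by_contra hlt
  have hδ : muInvariant p (I.H ⧸ K.Z) = 0 := by omega
  obtain ⟨s, hs, hsp⟩ := exists_isEulerSystemClass_not_mem_pow_eulerLoss_succ K hL hZ
  rw [hδ, zero_add, pow_one] at hsp
  obtain ⟨J, hJ⟩ :=
    Summit.BirchSwinnertonDyer.Rank1Residual.X10.coreTheoremA_classX9_of_oddPrime
      Summit.BirchSwinnertonDyer.Rank1Residual.X10.coreTheoremAOddPrime_holds W p κ γ I hX9 hκ hγ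
      ⟨s, hs, hsp⟩
  haveI : Finite (Y.X ⧸ (augIdealP p • (⊤ : Submodule (IwasawaAlgebra p) Y.X))) :=
    Y.finite_quotient_augIdealP_of_finite_pTorsion
      (W.finite_fineSelmerInfty_pTorsion_of_forall_iterate_eq_zero κ hγ hJ)
  let 𝔭 : PrimeSpectrum (IwasawaAlgebra p) := ⟨augIdealP p, isPrime_augIdealP_holds p⟩
  have hY0 : lengthAt (IwasawaAlgebra p) Y.X 𝔭 = 0 :=
    Summit.BirchSwinnertonDyer.BirchSwinnertonDyer.Rank1Residual.KatoMuSkeleton.lengthAt_eq_zero_of_finite_quotient_p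
      (M := Y.X) 𝔭 rfl
  apply hY
  rw [muInvariant_eq_toNat_lengthAt p Y.X 𝔭 rfl, hY0]
  rfl

end Package

/-! ## §3 The bookkeeping edge of road (iii): S-es-3 ⟹ the node, modulo F1_ζ ALONE; the LINE's composition -/

section RoadThree

/-- **ROAD (iii) EDGE — S-es-3 `SIM.FineMuLeEulerLossOnClassX9` ⟹ the node `SIM.KatoDivisibilityOnClassX9`, modulo
F1_ζ ALONE** (no `thm12_4`, no BCS 2025 (a), no modularity witness — the node quantifies over the newforms of `W` —
no S-W⁺).  Per pair and package: some genuine class has loss `≤ δ_Z`; S-es-3 at `n = δ_Z` gives `μ(X₀) ≤ δ_Z`; the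
lever `SIM.mem_charIdeal_of_fineMu_le_eulerLoss` (Kato 17.4 (3) with the `(p)`-part replaced) puts `G₁`,
`ι G₁ = L_p(f, α)` (GV Prop. 3.7), in `ch_Λ X(E/ℚ_∞)`.  The host's «stub_bookkeeping» with three binders removed.
[cite: Kato2004Asterisque, Thm. 12.6 (p. 222), Thm. 17.4 (p. 273), §17.13 (pp. 279–280)] [cite: GreenbergVatsal2000, Prop. 3.7] -/
theorem katoDivisibilityOnClassX9_of_fineMuLeEulerLossOnClassX9
    (hfine : exists_divisibilityInputs_fineQuotient_zeta) (h3 : FineMuLeEulerLossOnClassX9) :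
    KatoDivisibilityOnClassX9 := by
  intro W _ _ p _ κ γ N _ f hX9 hκ hγ hγ' hf D
  obtain ⟨-, h5, hgood, hap, hirr, -⟩ := id hX9
  have hp2 : p ≠ 2 := by omega
  have hord : IsOrdinaryAt W p := ⟨hgood, hap⟩
  haveI : ContinuousSMul ℤ_[p] (W.tateModule p) := TateModule.continuousSMul_padicInt
  haveI : Module.Free ℤ_[p] (W.tateModule p) := W.module_free_tateModule_holds p
  haveI : Module.Finite ℤ_[p] (W.tateModule p) := W.module_finite_tateModule_holds p
  obtain ⟨I⟩ := nonempty_iwasawaH1Data_holds W p κ γ hκ hγ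
  haveI : Module.Finite (IwasawaAlgebra p) D.X :=
    WeierstrassCurve.SelmerDualData.module_finite_of_isCyclotomic W κ hκ D hγ
  obtain ⟨Y⟩ := W.nonempty_fineSelmerDualData κ hγ
  obtain ⟨K, π, hπs, hπ, hZ⟩ := hfine W p f κ γ hp2 hord hκ hγ hγ' hf I D Y
  haveI : Module.Finite (IwasawaAlgebra p) Y.X := Module.Finite.of_surjective π hπs
  have hYt : Module.IsTorsion (IwasawaAlgebra p) Y.X := Kim2025.isTorsion_fine_of_package K π hπs hπ
  obtain ⟨G₁, hG₁⟩ := exists_iwasawaToPowerSeries_eq_padicLFunction hp2 hord hf hirr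
  have hL : padicLFunction f (unitRoot W p : ℚ_[p]) ≠ 0 := padicLFunction_unitRoot_ne_zero hord hf
  obtain ⟨s, hs, hsn⟩ := exists_isEulerSystemClass_not_mem_pow_eulerLoss_succ K hL hZ
  have hμ : muInvariant p Y.X ≤ muInvariant p (I.H ⧸ K.Z) :=
    h3 W p κ γ I (muInvariant p (I.H ⧸ K.Z)) hX9 hκ hγ hγ' ⟨s, hs, hsn⟩ Y
  exact ⟨G₁, mem_charIdeal_of_fineMu_le_eulerLoss K hirr hord hf hG₁ π hπs hπ hYt hμ, hG₁⟩

/-- **The same edge concluding the ROUTE decl** `OneSidedTwistSqueezeX9.KatoDivisibilityX9`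
(stmt-BirchSwinnertonDyer-20547; the route decl is the node by `rfl`). [cite: Kato2004Asterisque, §17.13 (pp. 279–280)] -/
theorem katoDivisibilityX9_of_fineMuLeEulerLossOnClassX9
    (hfine : exists_divisibilityInputs_fineQuotient_zeta) (h3 : FineMuLeEulerLossOnClassX9) :
    KatoDivisibilityX9 :=
  katoDivisibilityOnClassX9_of_fineMuLeEulerLossOnClassX9 hfine h3

/-- **ROAD (iii) COMPOSITION, kernel-checked: F1_ζ ∧ ES-C4 (depth; `n = 0` slice proved,
`SIM.fineExponentLeEulerLossOnClassX9_zero`) ∧ B2 (width `≤ 1`) ⟹ the crux `KatoDivisibilityX9`**, through the landed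
edge `SIM.fineMuLeEulerLossOnClassX9_of_exponent_of_concentrated` and the edge above — the composition of the line
`Cruxes/KatoDivisibilityX9/Lines/graded_euler_loss.lean` (both stubs OPEN, implied by item 19630 mod F1_ζ; nothing
asserted). [cite: Kato2004Asterisque, Thm. 13.4 (p. 226), §13.8, §17.13 (pp. 279–280)] -/
theorem katoDivisibilityX9_of_depth_of_width (hfine : exists_divisibilityInputs_fineQuotient_zeta)
    (h4 : FineExponentLeEulerLossOnClassX9) (hB : FineMuConcentratedOnClassX9) : KatoDivisibilityX9 :=
  katoDivisibilityX9_of_fineMuLeEulerLossOnClassX9 hfine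
    (fineMuLeEulerLossOnClassX9_of_exponent_of_concentrated h4 hB)

end RoadThree

/-! ## §4 The `n = 0`-core slack: Kato's divisibility wherever the dual fine Selmer group has `μ ≤ 1` -/

section FineMuLeOne

variable {W : WeierstrassCurve ℚ} [W.IsElliptic] [W.IsGloballyMinimal] {p : ℕ} [Fact p.Prime]

/-- **«Fine `μ ≤ 1` suffices» at the pair, modulo F1_ζ alone**: at an X9 pair all of whose finitely generated
torsion dual fine Selmer data over `ℚ_∞` have `μ(X₀) ≤ 1`, `KatoDivisibilityAt W p` holds (`μ(X₀) = 1 ⟹ δ_Z ≥ 1`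
by the `n = 0` core; then the lever).  Reading: the open content of stmt-20547 sits on `{μ(X₀) ≥ 2} ∩ {δ_Z ≥ 1}`;
LINE A's stub «Conjecture A on X9» may be weakened from `μ(X₀) = 0` to `μ(X₀) ≤ 1` at no cost.
[cite: Kato2004Asterisque, Thm. 12.6 (p. 222), §13.8, Thm. 17.4 (p. 273), §17.13 (pp. 279–280)]
[cite: CoatesSujatha2005, §3 Conjecture A (the case `μ(X₀) = 0`)] -/
theorem katoDivisibilityAt_of_fineMu_le_one (hfine : exists_divisibilityInputs_fineQuotient_zeta)
    (hX9 : ClassX9 W p)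
    (h1 : ∀ (κ : ZpExtension ℚ p) (γ : absoluteGaloisGroup ℚ), κ.IsCyclotomic → κ.IsTopGenerator γ →
      IsCyclotomicVariable p γ → ∀ Y : W.FineSelmerDualData κ γ,
        Module.Finite (IwasawaAlgebra p) Y.X → Module.IsTorsion (IwasawaAlgebra p) Y.X →
        muInvariant p Y.X ≤ 1) :
    KatoDivisibilityAt W p := by
  intro κ γ N _ f hκ hγ hγ' hf D
  obtain ⟨-, h5, hgood, hap, hirr, -⟩ := id hX9
  have hp2 : p ≠ 2 := by omega
  have hord : IsOrdinaryAt W p := ⟨hgood, hap⟩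
  haveI : ContinuousSMul ℤ_[p] (W.tateModule p) := TateModule.continuousSMul_padicInt
  haveI : Module.Free ℤ_[p] (W.tateModule p) := W.module_free_tateModule_holds p
  haveI : Module.Finite ℤ_[p] (W.tateModule p) := W.module_finite_tateModule_holds p
  obtain ⟨I⟩ := nonempty_iwasawaH1Data_holds W p κ γ hκ hγ
  haveI : Module.Finite (IwasawaAlgebra p) D.X :=
    WeierstrassCurve.SelmerDualData.module_finite_of_isCyclotomic W κ hκ D hγ
  obtain ⟨Y⟩ := W.nonempty_fineSelmerDualData κ hγ
  obtain ⟨K, π, hπs, hπ, hZ⟩ := hfine W p f κ γ hp2 hord hκ hγ hγ' hf I D Y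
  haveI hYf : Module.Finite (IwasawaAlgebra p) Y.X := Module.Finite.of_surjective π hπs
  have hYt : Module.IsTorsion (IwasawaAlgebra p) Y.X := Kim2025.isTorsion_fine_of_package K π hπs hπ
  obtain ⟨G₁, hG₁⟩ := exists_iwasawaToPowerSeries_eq_padicLFunction hp2 hord hf hirr
  have hL : padicLFunction f (unitRoot W p : ℚ_[p]) ≠ 0 := padicLFunction_unitRoot_ne_zero hord hf
  have hμ1 : muInvariant p Y.X ≤ 1 := h1 κ γ hκ hγ hγ' Y hYf hYt
  have hμ : muInvariant p Y.X ≤ muInvariant p (I.H ⧸ K.Z) := by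
    by_cases h0 : muInvariant p Y.X = 0
    · rw [h0]; exact Nat.zero_le _
    · exact hμ1.trans (one_le_eulerLoss_of_fineMu_ne_zero hX9 hκ hγ K hL hZ Y h0)
  exact ⟨G₁, mem_charIdeal_of_fineMu_le_eulerLoss K hirr hord hf hG₁ π hπs hπ hYt hμ, hG₁⟩

/-- **«Fine `μ ≤ 1` on X9» ⟹ the node `SIM.KatoDivisibilityOnClassX9`, modulo F1_ζ alone** (LINE A's stub
weakened to «`μ(X₀) ≤ 1` at every X9 pair» — still open-problem grade; nothing asserted about it).
[cite: Kato2004Asterisque, Thm. 17.4 (p. 273), §17.13 (pp. 279–280)] [cite: CoatesSujatha2005, §3 Conjecture A] -/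
theorem katoDivisibilityOnClassX9_of_fineMu_le_one (hfine : exists_divisibilityInputs_fineQuotient_zeta)
    (h1 : ∀ (W : WeierstrassCurve ℚ) [W.IsElliptic] [W.IsGloballyMinimal] (p : ℕ) [Fact p.Prime],
      ClassX9 W p → ∀ (κ : ZpExtension ℚ p) (γ : absoluteGaloisGroup ℚ), κ.IsCyclotomic →
      κ.IsTopGenerator γ → IsCyclotomicVariable p γ → ∀ Y : W.FineSelmerDualData κ γ,
        Module.Finite (IwasawaAlgebra p) Y.X → Module.IsTorsion (IwasawaAlgebra p) Y.X →
        muInvariant p Y.X ≤ 1) :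
    KatoDivisibilityOnClassX9 :=
  fun W _ _ p _ κ γ _ _ f hX9 hκ hγ hγ' hf D ↦
    katoDivisibilityAt_of_fineMu_le_one hfine hX9 (h1 W p hX9) κ γ f hκ hγ hγ' hf D

/-- **The route decl from «fine `μ ≤ 1` on X9» and F1_ζ** (stmt-BirchSwinnertonDyer-20547 by name).
[cite: Kato2004Asterisque, §17.13 (pp. 279–280)] -/
theorem katoDivisibilityX9_of_fineMu_le_one (hfine : exists_divisibilityInputs_fineQuotient_zeta)
    (h1 : ∀ (W : WeierstrassCurve ℚ) [W.IsElliptic] [W.IsGloballyMinimal] (p : ℕ) [Fact p.Prime],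
      ClassX9 W p → ∀ (κ : ZpExtension ℚ p) (γ : absoluteGaloisGroup ℚ), κ.IsCyclotomic →
      κ.IsTopGenerator γ → IsCyclotomicVariable p γ → ∀ Y : W.FineSelmerDualData κ γ,
        Module.Finite (IwasawaAlgebra p) Y.X → Module.IsTorsion (IwasawaAlgebra p) Y.X →
        muInvariant p Y.X ≤ 1) :
    KatoDivisibilityX9 :=
  katoDivisibilityOnClassX9_of_fineMu_le_one hfine h1

end FineMuLeOne

end Summit.BirchSwinnertonDyer.BirchSwinnertonDyer.Theorems.OneSidedTwistSqueezeX9KatoDivisibilityX9OfGradedEulerLoss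

end
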